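import Mathlib

/-!
# Uniqueness of the isotropic splitting of the W4 evaluation class (THEOREM A, W4 instance)

HONEST FRAMING. Lean index of the computation cell `pub-hsemireg` (W4 widening, lattice-first seat w4-lat-2,
gen 12; docs of record `widen/W4/lat2/code11/THETA-XI-w4lat2.md` §4b–§4c (w4-lat-2 g11) and
`widen/W4/w4rep2/g10/theory/SIGMA-w4rep2g10.md` §3 THEOREM A (w4-rep-2 g10)). Elementary integer arithmetic
only: no abelian surface, no sheaf and no Hodge-theoretic statement is formalised here, and nothing in this file
says HC, HC_CM or HC_AV is proved. No `sorry`, no axiom beyond the standard three, no named fact, no `def`.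

CONTEXT (informal, not formalised). On a very general `(1,d)`-polarised abelian surface `B̄` (`NS = ℤν̄`,
`ν̄² = 2d`) write Mukai vectors as integer triples `(r, c, a)` = (rank, coefficient of `ν̄` in `c₁`, `χ`), with
pairing `⟨(r,c,a),(r',c',a')⟩ = 2d·c·c' − (r·a' + r'·a)`; a vector is isotropic iff `d·c² = r·a`. For the cell
`(n; m, dm)` the evaluation map `ev : H⁰(E) ⊗ 𝒪 → E` of the simple semi-homogeneous bundle `E = E_{m/n}`
(`v(E) = (n², nm, dm²)`, `χ = dm²`) has kernel `𝒦` and cokernel `𝒬` with `v(𝒬) − v(𝒦) = v(E) − χ·v(𝒪) =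
(n² − dm², nm, dm²)`. HYPOTHESIS Σ (w4-lat-2 g11) says `𝒦` and `𝒬` are semi-homogeneous, hence have
isotropic Mukai vectors; rep-2's LEMMA 1 gives `slope(𝒦) < 0`, LEMMA 0 gives `1 ≤ rk 𝒦 ≤ χ − 1` in a defect cell.
THEOREM A (rep-2 g10) says these conditions leave finitely many integral possibilities (a Pell orbit cut by
inequalities), exactly ONE in 152 of 172 cells, among them the W4 cell `(7; 4, 12)` (`d = 3`), where the unique
pair is `v(𝒦) = (3, −12, 144) = 3·v(N̄⁻⁴)`, `v(𝒬) = (4, 16, 192) = 4·v(N̄⁴)` — the measured ranks (kernel 3,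
cokernel 4 of the 49 × 48 theta matrix) and rep-2 g9's explicit kernel sheaf.

WHAT IS PROVED HERE (kernel-checked integer arithmetic).
* `key_identity`: for any `d, n, m` and any integral isotropic pair with the evaluation difference,
  `d² · ((n² − dm²)·c_K − nm·r_K)² = d³·m⁴·r_K·r_Q` — so under Σ the product `d·r_K·r_Q` is a perfect square
  (times `m⁴`), the arithmetic shadow of the Pell orbit.
* `kernel_rank_eq_three`: `768·r·(r+1)` is a perfect square with `1 ≤ r ≤ 47` only for `r = 3`.
* `lambdaSheaf_unique_W4`: for `d = 3`, `(n, m) = (7, 4)`: the only integral isotropic pair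
  `(v_K, v_Q)` with `v_Q − v_K = (1, 28, 48)`, `1 ≤ r_K ≤ 47` and `c_K < 0` is `((3, −12, 144), (4, 16, 192))`
  (the cokernel-slope condition `c_Q/r_Q > 4/7` of THEOREM A is not needed in this cell; it holds: `16/4 > 4/7`).
* `lambdaSheaf_W4_check`: that pair does satisfy every condition of THEOREM A.
-/

namespace Summit.Ventures.HSemireg.LambdaSheafUniquenessW4

/-- The Pell shadow of Σ in a general cell `(n; m, dm)`: if `v_K = (r, c, a)` and
`v_Q = (r + (n² − dm²), c + nm, a + dm²)` are both isotropic for the pairing with `ν̄² = 2d`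
(`d·c² = r·a`), then `d²·((n² − d m²)·c − n m·r)² = d³·m⁴·r·(r + (n² − d m²))`. -/
theorem key_identity (d n m r c a : ℤ) (hK : d * c ^ 2 = r * a)
    (hQ : d * (c + n * m) ^ 2 = (r + (n ^ 2 - d * m ^ 2)) * (a + d * m ^ 2)) :
    d ^ 2 * ((n ^ 2 - d * m ^ 2) * c - n * m * r) ^ 2
      = d ^ 3 * m ^ 4 * r * (r + (n ^ 2 - d * m ^ 2)) := by
  linear_combination (d * (n ^ 2 - d * m ^ 2) * ((n ^ 2 - d * m ^ 2) + r)) * hK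
    - (d * (n ^ 2 - d * m ^ 2) * r) * hQ

/-- The W4 instance of `key_identity` with the factor `d² = 9` cancelled: for `d = 3`, `(n, m) = (7, 4)`
(`n² − dm² = 1`, `nm = 28`, `dm² = 48`): `(c − 28 r)² = 768 · r · (r + 1)`, and the Euler
characteristic of the kernel vector is `a = 168 c + 2304 − 48 r`. -/
theorem key_identity_W4 (r c a : ℤ) (hK : 3 * c ^ 2 = r * a)
    (hQ : 3 * (c + 28) ^ 2 = (r + 1) * (a + 48)) :
    (c - 28 * r) ^ 2 = 768 * (r * (r + 1)) ∧ a = 168 * c + 2304 - 48 * r := by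
  refine ⟨?_, by linear_combination hK - hQ⟩
  have h3 : (3 : ℤ) * (c - 28 * r) ^ 2 = 3 * (768 * (r * (r + 1))) := by
    linear_combination (1 + r) * hK - r * hQ
  exact mul_left_cancel₀ three_ne_zero h3

/-- A square equals the literal on the right: then that literal is a square (bookkeeping for `norm_num`). -/
theorem isSquare_of_sq_eq {t N : ℤ} (h : t ^ 2 = N) : IsSquare N :=
  ⟨t, by rw [← h, sq]⟩

/-- `768 · r · (r + 1)` is a perfect square with `1 ≤ r ≤ 47` only for `r = 3` (`768 · 12 = 96²`);
the next solution of the underlying Pell equation `(2r+1)² − 12 s² = 1` is `r = 48 = χ`, the trivial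
splitting `𝒦 = 𝒪^χ`, excluded by `rk 𝒦 ≤ χ − 1`. Proof: `interval_cases` and 46 `norm_num` non-square checks (the `IsSquare` extension). -/
theorem kernel_rank_eq_three (r t : ℤ) (hr1 : 1 ≤ r) (hr2 : r ≤ 47)
    (h : t ^ 2 = 768 * (r * (r + 1))) : r = 3 := by
  interval_cases r <;> norm_num at h <;>
    first
    | rfl
    | (have hs := isSquare_of_sq_eq h; norm_num at hs)

/-- THEOREM A, W4 instance (`d = 3`, `(n; m, dm) = (7; 4, 12)`, `v(E) − χ v(𝒪) = (1, 28, 48)`):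
the only pair of integral isotropic Mukai vectors `v_K = (r_K, c_K, a_K)`, `v_Q = (r_Q, c_Q, a_Q)` with
`v_Q − v_K = (1, 28, 48)`, `1 ≤ r_K ≤ 47` and negative kernel slope (`c_K < 0`) is
`v_K = (3, −12, 144) = 3·v(N̄⁻⁴)`, `v_Q = (4, 16, 192) = 4·v(N̄⁴)`. -/
theorem lambdaSheaf_unique_W4 (rK cK aK rQ cQ aQ : ℤ)
    (hisoK : 3 * cK ^ 2 = rK * aK) (hisoQ : 3 * cQ ^ 2 = rQ * aQ)
    (hr : rQ = rK + 1) (hc : cQ = cK + 28) (ha : aQ = aK + 48)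
    (hr1 : 1 ≤ rK) (hr2 : rK ≤ 47) (hneg : cK < 0) :
    rK = 3 ∧ cK = -12 ∧ aK = 144 ∧ rQ = 4 ∧ cQ = 16 ∧ aQ = 192 := by
  subst hr hc ha
  obtain ⟨hsq, haK⟩ := key_identity_W4 rK cK aK hisoK hisoQ
  have hr3 : rK = 3 := kernel_rank_eq_three rK (cK - 28 * rK) hr1 hr2 hsq
  subst hr3
  have hfac : (cK + 12) * (cK - 180) = 0 := by linear_combination hsq
  rcases mul_eq_zero.1 hfac with h1 | h2
  · have hcK : cK = -12 := by linarith
    subst hcK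
    norm_num at haK ⊢
    omega
  · exfalso; linarith

/-- The pair of `lambdaSheaf_unique_W4` satisfies every condition of THEOREM A for the W4 cell:
both vectors isotropic (`3·c² = r·a`), difference `(1, 28, 48)`, `1 ≤ r_K ≤ 47`, `1 ≤ r_Q ≤ 48`,
kernel slope negative and cokernel slope `c_Q / r_Q = 4 > 4/7 = m/n` (as `7·c_Q > 4·r_Q`). -/
theorem lambdaSheaf_W4_check :
    (3 : ℤ) * (-12) ^ 2 = 3 * 144 ∧ (3 : ℤ) * 16 ^ 2 = 4 * 192 ∧
    ((4 : ℤ) - 3, (16 : ℤ) - (-12), (192 : ℤ) - 144) = (1, 28, 48) ∧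
    (1 : ℤ) ≤ 3 ∧ (3 : ℤ) ≤ 47 ∧ (1 : ℤ) ≤ 4 ∧ (4 : ℤ) ≤ 48 ∧ (-12 : ℤ) < 0 ∧ (7 : ℤ) * 16 > 4 * 4 := by
  norm_num

end Summit.Ventures.HSemireg.LambdaSheafUniquenessW4
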